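import Summits.KontsevichZagierPeriods.KontsevichZagierPeriods.Theorems.SoloInformedKZPOneKernel
import Literature.NumberTheory.Transcendental.KZRelationsLE
import HarnessLib
import HarnessLib.Audit

/-!
# SoloInformed — ℚ̄-linear relations among rational integrals of dimension ≤ 1 are Kontsevich–Zagier relations

Solo programme `solo-KontsevichZagierPeriods-informed`, session s112, file 12 — the BAKER-SHAPED
form of the kernel property.  Baker's theorem is a statement about `ℚ̄`-linear forms in
logarithms; the natural move-level counterpart is: if real algebraic numbers `a_i` and rational
integral representations `r_i` of dimension `≤ 1` satisfy `Σ_i a_i · value(r_i) = 0`, then the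
formal sum of the SCALED representations `[D_i, a_i · (P_i/Q_i)]` is a relation
(`soloInformed_sum_constMul_of_mem_relations`).  The scaled representations are no longer of KZ's
literal rational shape (`a_i` irrational algebraic), so this extends files 10–11; in particular the
period conjecture holds pairwise for representations of the shape
`[D, a · P/Q]`, `a ∈ ℚ̄ ∩ ℝ`, `P, Q ∈ ℚ[x]`, `dim D ≤ 1` (`soloInformed_equivalent_constMul_of_isRational`).

Engine: the tree's scaling endomorphism `KZ.scale a` [Kontsevich–Zagier 2001, §1.1–1.2;
`Literature/…/KZRelationsLE.lean`] preserves relations (`KZ.scale_mem_relations`) and maps points to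
points and segments to segments (`Seg(g,c) ↦ Seg(a g, c)`), hence preserves the span of points and
segments (`soloInformed_scale_mem_segSpan`), on which the kernel conjecture holds (file 7).

Honest placement: the pairwise `ℚ`-coefficient sector is in the tree by other seats
(`kzPeriodConjecture_dim_le_one`, names only — membrane); no tree declaration with an
algebraic-coefficient / `ℚ̄`-linear kernel statement of this shape was found by name search
(`lean search` for `QbarLinear`, `algLinear`, `constMul.*dim`, `scale_mem_.*Span`: no hits in
`Summits/KontsevichZagierPeriods` except linear INDEPENDENCE results).

References: A. Baker, *Transcendental Number Theory* (1975), Thm. 2.1; M. Kontsevich, D. Zagier,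
*Periods* (2001), §1.1 ("rational" may be replaced by "algebraic"), §1.2.
-/

noncomputable section

open scoped BigOperators

namespace Summit.KontsevichZagierPeriods.KontsevichZagierPeriods.Theorems

open Set
open Literature.NumberTheory.Transcendental Literature.NumberTheory.Transcendental.KZ

/-- Scaling a segment by a real algebraic constant is the segment with scaled weight:
`a · Seg(g,c) ≡ Seg(a g, c)`; scaling a point representation gives the point representation of
the product. -/
theorem soloInformed_scale_generators {a : ℝ} (ha : IsAlgebraic ℚ a) :
    (∀ (b : ℝ) (hb : IsAlgebraic ℚ b),
      of ((soloInformedPtRep b hb).constMul a ha) - of (soloInformedPtRep (a * b) (ha.mul hb)) ∈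
        relations) ∧
    ∀ g c : ℂ, SoloInformedSegAdm g c →
      SoloInformedSegAdm ((a : ℂ) * g) c ∧
      of ((soloInformedSegRep g c).constMul a ha) - of (soloInformedSegRep ((a : ℂ) * g) c) ∈
        relations := by
  refine ⟨fun b hb => ?_, fun g c h => ?_⟩
  · exact of_sub_of_mem_relations_of_eqOn (by simp) fun y _ => by simp
  · have hadm : SoloInformedSegAdm ((a : ℂ) * g) c :=
      ⟨(soloInformed_isAlgebraic_ofReal_pair ha ha).1.mul h.1, h.2.1, h.2.2⟩
    refine ⟨hadm, of_sub_of_mem_relations_of_eqOn (by simp) fun y _ => ?_⟩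
    rw [IntegralRep.integrand_constMul, soloInformed_segRep_integrand h,
      soloInformed_segRep_integrand hadm]
    show a * soloInformedSegFun g c y = soloInformedSegFun ((a : ℂ) * g) c y
    simp only [soloInformedSegFun, mul_assoc, Complex.re_ofReal_mul]

/-- **The scaling endomorphism preserves the span of points and segments.** -/
theorem soloInformed_scale_mem_segSpan {a : ℝ} (ha : IsAlgebraic ℚ a) {x : FormalRep}
    (hx : x ∈ soloInformedSegSpan) : scale a ha x ∈ soloInformedSegSpan := by
  refine AddSubgroup.closure_induction (p := fun y _ => scale a ha y ∈ soloInformedSegSpan)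
    ?_ ?_ ?_ ?_ hx
  · rintro y ((hy | ⟨b, hb, rfl⟩) | ⟨g, c, hgc, rfl⟩)
    · exact soloInformed_relations_le_segSpan (scale_mem_relations a ha hy)
    · rw [scale_of]
      exact soloInformed_mem_segSpan_of_sub_mem ((soloInformed_scale_generators ha).1 b hb)
        (soloInformed_ptRep_mem_segSpan _ _)
    · rw [scale_of]
      obtain ⟨hadm, hrel⟩ := (soloInformed_scale_generators ha).2 g c hgc
      exact soloInformed_mem_segSpan_of_sub_mem hrel (soloInformed_segRep_mem_segSpan hadm)
  · rw [map_zero]; exact zero_mem _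
  · intro y z _ _ hy hz
    rw [map_add]; exact add_mem hy hz
  · intro y _ hy
    rw [map_neg]; exact neg_mem hy

/-- Scaled rational representations of dimension `≤ 1` lie in the span of points and segments. -/
theorem soloInformed_constMul_mem_segSpan {n : ℕ} (hn : n ≤ 1) (r : IntegralRep n)
    (hr : r.IsRational) {a : ℝ} (ha : IsAlgebraic ℚ a) :
    of (r.constMul a ha) ∈ soloInformedSegSpan := by
  rw [← scale_of]
  exact soloInformed_scale_mem_segSpan ha (soloInformed_of_mem_segSpan_of_isRational hn r hr)

/-- **`ℚ̄`-linear relations among rational integrals of dimension `≤ 1` are Kontsevich–Zagier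
relations** (unconditional; the move-level form of Baker's theorem on linear forms in logarithms):
if `Σ_{i ∈ s} a_i · value(r_i) = 0` with `a_i ∈ ℚ̄ ∩ ℝ` and `r_i` rational of dimension `n_i ≤ 1`,
then `Σ_{i ∈ s} [D_i, a_i · f_i] ∈ relations`. [Baker 1975, Thm. 2.1; Kontsevich–Zagier 2001, §1.2;
this work] -/
theorem soloInformed_sum_constMul_of_mem_relations {ι : Type*} (s : Finset ι) (n : ι → ℕ)
    (r : ∀ i, IntegralRep (n i)) (a : ι → ℝ) (ha : ∀ i, IsAlgebraic ℚ (a i))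
    (hn : ∀ i ∈ s, n i ≤ 1) (hr : ∀ i ∈ s, (r i).IsRational)
    (h0 : ∑ i ∈ s, a i * (r i).value = 0) :
    ∑ i ∈ s, of ((r i).constMul (a i) (ha i)) ∈ relations := by
  refine soloInformed_mem_relations_of_mem_segSpan
    (soloInformed_sum_mem_segSpan _ fun i hi =>
      soloInformed_constMul_mem_segSpan (hn i hi) (r i) (hr i hi) (ha i)) ?_
  rw [map_sum]
  simpa only [eval_of, IntegralRep.value_constMul] using h0

/-- **The period conjecture for scaled rational representations of dimension `≤ 1`**: two
representations `[D, a·P/Q]`, `[D', a'·P'/Q']` (`a, a' ∈ ℚ̄ ∩ ℝ`, `P, Q, P', Q'` with rational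
coefficients, `dim D, dim D' ≤ 1`) with the same value are KZ-equivalent. [this work] -/
theorem soloInformed_equivalent_constMul_of_isRational {n m : ℕ} (hn : n ≤ 1) (hm : m ≤ 1)
    {r : IntegralRep n} {r' : IntegralRep m} (hr : r.IsRational) (hr' : r'.IsRational)
    {a a' : ℝ} (ha : IsAlgebraic ℚ a) (ha' : IsAlgebraic ℚ a')
    (hv : (r.constMul a ha).value = (r'.constMul a' ha').value) :
    Equivalent (r.constMul a ha) (r'.constMul a' ha') :=
  soloInformed_equivalent_of_mem_segSpan (soloInformed_constMul_mem_segSpan hn r hr ha)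
    (soloInformed_constMul_mem_segSpan hm r' hr' ha') hv

/-- The kernel conjecture on the `scale`-stable subgroup generated by the rational representations
of dimension `≤ 1`: for `x` in the subgroup generated by all `scale a (of r)` (`a ∈ ℚ̄ ∩ ℝ`,
`r` rational, `dim r ≤ 1`), `x ∈ relations ↔ eval x = 0`. [this work] -/
theorem soloInformed_mem_relations_iff_of_mem_scaleRatLEOneSpan {x : FormalRep}
    (hx : x ∈ AddSubgroup.closure {y : FormalRep | ∃ (a : ℝ) (ha : IsAlgebraic ℚ a) (n : ℕ)
      (r : IntegralRep n), n ≤ 1 ∧ r.IsRational ∧ y = scale a ha (of r)}) :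
    x ∈ relations ↔ eval x = 0 := by
  have hle : AddSubgroup.closure {y : FormalRep | ∃ (a : ℝ) (ha : IsAlgebraic ℚ a) (n : ℕ)
      (r : IntegralRep n), n ≤ 1 ∧ r.IsRational ∧ y = scale a ha (of r)} ≤ soloInformedSegSpan :=
    (AddSubgroup.closure_le _).2 fun _ ⟨a, ha, n, r, hn, hr, hy⟩ =>
      hy ▸ soloInformed_scale_mem_segSpan ha (soloInformed_of_mem_segSpan_of_isRational hn r hr)
  exact ⟨fun h => relations_le_ker_eval_holds h, fun h0 =>
    soloInformed_mem_relations_of_mem_segSpan (hle hx) h0⟩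

end Summit.KontsevichZagierPeriods.KontsevichZagierPeriods.Theorems
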